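import Literature.Analysis.InnerProduct.CourantFischerBounds

/-!
# Interlacing under a form-nonnegative perturbation supported off a hyperplane
# (rank-one PSD update), from the Courant–Fischer trial inequalities

Topic `Literature/Analysis/InnerProduct` (next to `CourantFischerBounds`). Horn–Johnson,
*Matrix Analysis*, 2nd ed., **Corollary 4.3.9** ("the interlacing theorem for a rank-one Hermitian
perturbation of a Hermitian matrix"): for Hermitian `A ∈ M_n` and `z ≠ 0`,
`λ_i(A) ≤ λ_i(A + zz*) ≤ λ_{i+1}(A)` (ascending order, (4.3.10)). In Mathlib's antitone enumeration
`λ₀ ≥ λ₁ ≥ ⋯ ≥ λ_{n-1}` of `LinearMap.IsSymmetric.eigenvalues` this reads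
`λ_k(T) ≤ λ_k(S) ≤ λ_{k-1}(T)`, and we prove it in the slightly more general form in which the
perturbation `S − T` is only assumed to be form-nonnegative with `⟪S x, x⟫ = ⟪T x, x⟫` on a hyperplane
`vᗮ` (a rank-one PSD update `S = T + |v⟩⟨v|` is the case of interest):

* `eigenvalues_le_of_re_inner_sub_nonneg` — the monotonicity half `λ_k(T) ≤ λ_k(S)` (Weyl's lower
  inequality with `c = 0`, Horn–Johnson Cor. 4.3.12);
* `eigenvalues_le_eigenvalues_pred_of_eq_on_orthogonal` — the interlacing half `λ_k(S) ≤ λ_{k-1}(T)`,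
  `k ≥ 1`: the trial subspace `span {b_{k-1}(T), …, b_{n-1}(T)} ⊓ vᗮ` has dimension `≥ n − k`, so by
  the min–max half of Courant–Fischer it carries `x ≠ 0` with `λ_k(S) ‖x‖² ≤ ⟪S x, x⟫ = ⟪T x, x⟫ ≤
  λ_{k-1}(T) ‖x‖²`;
* `rankOne_interlacing` — both halves together.

Everything is proved from `Literature.Analysis.InnerProduct.CourantFischerBounds` (trial-subspace
inequalities, tail-span dimension) and Mathlib's `Submodule.finrank_add_finrank_orthogonal`,
`Submodule.finrank_sup_add_finrank_inf_eq`. No definitions, no named facts.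

## References

* R. A. Horn, C. R. Johnson, *Matrix Analysis*, 2nd ed., CUP (2013), Cor. 4.3.9 (4.3.10) and
  Cor. 4.3.12. [HornJohnson2013]
-/

noncomputable section

open scoped InnerProductSpace
open Module

namespace Literature.Analysis.InnerProduct

variable {𝕜 : Type*} [RCLike 𝕜] {E : Type*} [NormedAddCommGroup E] [InnerProductSpace 𝕜 E]
  [FiniteDimensional 𝕜 E] {T S : E →ₗ[𝕜] E} {n : ℕ}

/-- **Monotonicity half** (Horn–Johnson Cor. 4.3.12 / the left inequality of (4.3.10)): a
form-nonnegative perturbation does not lower any sorted eigenvalue. [cite: HornJohnson2013, Cor 4.3.12] -/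
theorem eigenvalues_le_of_re_inner_sub_nonneg (hT : T.IsSymmetric) (hS : S.IsSymmetric)
    (hn : finrank 𝕜 E = n) (hpos : ∀ x : E, 0 ≤ RCLike.re ⟪(S - T) x, x⟫_𝕜) (k : Fin n) :
    hT.eigenvalues hn k ≤ hS.eigenvalues hn k := by
  have := eigenvalues_sub_le_eigenvalues_of_le_re_inner_sub hT hS hn (c := 0)
    (fun x => by simpa using hpos x) k
  simpa using this

/-- **Interlacing half** (the right inequality of Horn–Johnson (4.3.10)): if the forms of `S` and `T`
agree on the hyperplane `vᗮ`, then `λ_k(S) ≤ λ_{k-1}(T)` for every `k ≥ 1`. [cite: HornJohnson2013, Cor 4.3.9] -/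
theorem eigenvalues_le_eigenvalues_pred_of_eq_on_orthogonal (hT : T.IsSymmetric)
    (hS : S.IsSymmetric) (hn : finrank 𝕜 E = n) (v : E)
    (heq : ∀ x : E, ⟪v, x⟫_𝕜 = 0 → RCLike.re ⟪S x, x⟫_𝕜 = RCLike.re ⟪T x, x⟫_𝕜)
    (k : Fin n) (hk : 0 < (k : ℕ)) :
    hS.eigenvalues hn k ≤ hT.eigenvalues hn ⟨k - 1, by omega⟩ := by
  set k' : Fin n := ⟨k - 1, by omega⟩ with hk'
  set A := Submodule.span 𝕜 (Set.range fun j : {j : Fin n // k' ≤ j} => hT.eigenvectorBasis hn j)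
    with hA
  set B := (𝕜 ∙ v)ᗮ with hB
  have hAdim : finrank 𝕜 A = n - (k - 1) := by rw [hA, finrank_tailSpan hT hn k']
  have hBdim : n ≤ finrank 𝕜 B + 1 := by
    have h1 := Submodule.finrank_add_finrank_orthogonal (𝕜 ∙ v)
    have h2 : finrank 𝕜 (𝕜 ∙ v) ≤ 1 := by
      by_cases hv : v = 0
      · subst hv
        rw [Submodule.span_zero_singleton, finrank_bot]
        exact zero_le_one
      · rw [finrank_span_singleton hv]
    rw [hn] at h1
    rw [hB]
    omega
  have hW : n ≤ finrank 𝕜 (A ⊓ B : Submodule 𝕜 E) + k := by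
    have hsum := Submodule.finrank_sup_add_finrank_inf_eq A B
    have hle : finrank 𝕜 ↥(A ⊔ B) ≤ finrank 𝕜 E := Submodule.finrank_le _
    rw [hn] at hle
    omega
  obtain ⟨x, hxW, hx0, hle⟩ := exists_mem_eigenvalues_mul_le_re_inner hS hn k (A ⊓ B) hW
  have hxA : x ∈ A := hxW.1
  have hxB : x ∈ B := hxW.2
  have hvx : ⟪v, x⟫_𝕜 = 0 := by
    rw [hB, Submodule.mem_orthogonal_singleton_iff_inner_right] at hxB
    exact hxB
  have hT' : RCLike.re ⟪T x, x⟫_𝕜 ≤ hT.eigenvalues hn k' * ‖x‖ ^ 2 :=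
    re_inner_apply_self_le_of_inner_eq_zero hT hn k'
      (fun i hi => inner_eq_zero_of_mem_tailSpan hT hn k' hxA i hi)
  have hx2 : 0 < ‖x‖ ^ 2 := by positivity
  have h : hS.eigenvalues hn k * ‖x‖ ^ 2 ≤ hT.eigenvalues hn k' * ‖x‖ ^ 2 := by
    calc hS.eigenvalues hn k * ‖x‖ ^ 2 ≤ RCLike.re ⟪S x, x⟫_𝕜 := hle
      _ = RCLike.re ⟪T x, x⟫_𝕜 := heq x hvx
      _ ≤ hT.eigenvalues hn k' * ‖x‖ ^ 2 := hT'
  exact le_of_mul_le_mul_right h hx2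

/-- **Two-sided interlacing for a rank-one PSD update**, Horn–Johnson Cor. 4.3.9 (4.3.10), for
`S = T + |v⟩⟨v|` (or any form-nonnegative perturbation vanishing on `vᗮ`): `λ_k(T) ≤ λ_k(S) ≤ λ_{k-1}(T)`.
[cite: HornJohnson2013, Cor 4.3.9] -/
theorem rankOne_interlacing (hT : T.IsSymmetric) (hS : S.IsSymmetric) (hn : finrank 𝕜 E = n)
    (v : E) (hpos : ∀ x : E, 0 ≤ RCLike.re ⟪(S - T) x, x⟫_𝕜)
    (heq : ∀ x : E, ⟪v, x⟫_𝕜 = 0 → RCLike.re ⟪S x, x⟫_𝕜 = RCLike.re ⟪T x, x⟫_𝕜)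
    (k : Fin n) (hk : 0 < (k : ℕ)) :
    hT.eigenvalues hn k ≤ hS.eigenvalues hn k ∧
      hS.eigenvalues hn k ≤ hT.eigenvalues hn ⟨k - 1, by omega⟩ :=
  ⟨eigenvalues_le_of_re_inner_sub_nonneg hT hS hn hpos k,
    eigenvalues_le_eigenvalues_pred_of_eq_on_orthogonal hT hS hn v heq k hk⟩

end Literature.Analysis.InnerProduct

end
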